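import Summits.AnomalousDissipation.AnomalousDissipation.Theses.LimitingAbsorption

/-!
# Sketch (crux-ideate, ideator 2, round 1) — crux `FloorUpgrade` (stmt-AnomalousDissipation-15010)

First lemmas for the idea cards `origin-density-of-states` and `pinned-saddle-shot-noise`, plus the
one-line "contraction floor" recorded as barrier note B2 (it is NOT a floor for the steady source; see
NOTES.md).  Everything here elaborates; `contraction_floor` and `pinned_of_pointReflection` are proved.
-/

namespace Summit.AnomalousDissipation.AnomalousDissipation.Cruxes.FloorUpgrade.Ideator2

open MeasureTheory Set Filter
open scoped InnerProductSpace

/-! ## Card `origin-density-of-states`: the test-field (quasimode) certificate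

Testing the weak forced-scalar identity (`IsWeakScalarTransportForcedOn.weak_eq`, datum `0`, steady
source `h`) with a space–time test field `ψ` and applying Cauchy–Schwarz to `κ ∫∫ ∇θ·∇ψ` gives the
elementary DUAL CERTIFICATE
`(κ ∫₀ᵀ ‖∇ψ‖²) · (κ ∫₀ᵀ ‖∇θ‖²) ≥ ( ∫₀ᵀ∫ h ψ + ∫₀ᵀ∫ θ (∂ₜψ + u·∇ψ) )²`
— its optimiser over `ψ` is the Schur-complement / Avellaneda–Majda variational principle, and in the
inviscid scaling `ν ∫∫‖∇ψ‖² ≲ T`, `∫∫ θ(∂ₜ+u·∇)ψ = o(T)` it says: ν-near-invariant (in the `H⁻¹` sense)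
test fields correlated with `h` certify the absorbed-power floor.  Stated for the dissipation in its
`ℝ≥0∞` form (`eScalarDissipation`), finite by hypothesis. -/
def TestFieldCertificate : Prop :=
  ∀ (κ T : ℝ) (u : ℝ → UnitAddTorus (Fin 2) → EuclideanSpace ℝ (Fin 2))
    (h : UnitAddTorus (Fin 2) → ℝ) (θ ψ : ℝ → UnitAddTorus (Fin 2) → ℝ),
    0 < κ → 0 < T →
    Literature.Analysis.FluidPDE.Torus.IsWeakScalarTransportForcedOn T κ u (fun _ => h) 0 θ →
    Literature.Analysis.FunctionSpaces.Torus.IsSpaceTimeTest T ψ →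
    Literature.Analysis.FluidPDE.Torus.eScalarDissipation κ θ 0 T ≠ ⊤ →
    ((∫ t in Ioo 0 T, ∫ x, h x * ψ t x) +
        ∫ t in Ioo 0 T, ∫ x, θ t x *
          (Literature.Analysis.FunctionSpaces.Torus.timeDeriv ψ t x +
            ⟪u t x, Literature.Analysis.FunctionSpaces.Torus.gradient (ψ t) x⟫_ℝ)) ^ 2 ≤
      (κ * ∫ t in Ioo 0 T, Literature.Analysis.FluidPDE.Torus.scalarGradNormSq (ψ t)) *
        (Literature.Analysis.FluidPDE.Torus.eScalarDissipation κ θ 0 T).toReal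

/-- The family form that feeds the `(ABS)` clause of `UniformRelaxationWitness`: if along the family
one can exhibit, for every `j` and all large `T`, test fields with normalised numerator `≥ n₀` and
normalised `ν_j`-weighted gradient budget `≤ d₀`, the long-time mean dissipation is `≥ n₀² / d₀`
uniformly in `j` (quasimode / density-of-states-at-the-origin criterion, time-domain form). -/
def QuasimodeFloorCriterion : Prop :=
  ∀ (ν : ℕ → ℝ) (v : ℕ → ℝ → UnitAddTorus (Fin 2) → EuclideanSpace ℝ (Fin 2))
    (h : UnitAddTorus (Fin 2) → ℝ) (θ : ℕ → ℝ → UnitAddTorus (Fin 2) → ℝ) (n₀ d₀ : ℝ),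
    0 < n₀ → 0 < d₀ → (∀ j, 0 < ν j) →
    (∀ j, Literature.Analysis.FluidPDE.Torus.IsWeakScalarTransportForced (ν j) (v j) (fun _ => h) 0 (θ j)) →
    (∀ j, ∃ T₀ : ℝ, ∀ T, T₀ ≤ T → ∃ ψ : ℝ → UnitAddTorus (Fin 2) → ℝ,
        Literature.Analysis.FunctionSpaces.Torus.IsSpaceTimeTest T ψ ∧
        n₀ * T ≤ (∫ t in Ioo 0 T, ∫ x, h x * ψ t x) +
            ∫ t in Ioo 0 T, ∫ x, θ j t x *
              (Literature.Analysis.FunctionSpaces.Torus.timeDeriv ψ t x +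
                ⟪v j t x, Literature.Analysis.FunctionSpaces.Torus.gradient (ψ t) x⟫_ℝ) ∧
        (ν j * ∫ t in Ioo 0 T, Literature.Analysis.FluidPDE.Torus.scalarGradNormSq (ψ t)) ≤ d₀ * T) →
    ∀ j, n₀ ^ 2 / d₀ ≤ Literature.Analysis.FluidPDE.longTimeAvgSup
        (fun t => ν j * (Literature.Analysis.FluidPDE.Torus.eScalarGradNormSq (θ j t)).toReal)

/-! ## Barrier note B2: the one-line contraction floor (period map / renewal operator)

For ANY contraction `M` of a real inner-product space and `u` with `u - M u = h`:
`‖h‖² ≤ 2 ⟪u, h⟫`.  Read with `M` = scalar period map of a time-periodic stirring and `u = (1-M)⁻¹ h`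
= stroboscopic inventory, it is an exact floor for a KICKED source `h · Σₙ δ(t - nτ)`, not for the
steady one (NOTES.md B2). -/
theorem contraction_floor {V : Type*} [NormedAddCommGroup V] [InnerProductSpace ℝ V]
    (M : V → V) (hM : ∀ x, ‖M x‖ ≤ ‖x‖) (u h : V) (hu : u - M u = h) :
    ‖h‖ ^ 2 ≤ 2 * ⟪u, h⟫_ℝ := by
  subst hu
  have h1 : ‖u - M u‖ ^ 2 = ‖u‖ ^ 2 - 2 * ⟪u, M u⟫_ℝ + ‖M u‖ ^ 2 := by
    rw [@norm_sub_sq_real]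
  have h2 : ⟪u, u - M u⟫_ℝ = ‖u‖ ^ 2 - ⟪u, M u⟫_ℝ := by
    rw [inner_sub_right, real_inner_self_eq_norm_sq]
  have h3 : ‖M u‖ ^ 2 ≤ ‖u‖ ^ 2 := by
    have := hM u
    have h0 : 0 ≤ ‖M u‖ := norm_nonneg _
    nlinarith
  rw [h1, h2]
  nlinarith

/-! ## Card `pinned-saddle-shot-noise`

(a) Pinning: a point-reflection-equivariant planar field vanishes at the four 2-torsion points of
`T²` (for NS this equivariance is propagated from `(g, v₀)` by 2-D uniqueness).
(b) Residence: Gronwall gives the logarithmic residence time `Λ⁻¹ log(δ/r)` near a pinned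
stagnation point for every integral curve entering at distance `r` — the Lagrangian increments
`h(x_c) · Λ⁻¹ log(δ/b)` with `b` spread along an unstable leaf are the Exp-tailed "shot noise"
that no bounded transfer function absorbs (card). -/
theorem pinned_of_pointReflection
    (v : UnitAddTorus (Fin 2) → EuclideanSpace ℝ (Fin 2)) (hv : ∀ x, v (-x) = -v x)
    (x : UnitAddTorus (Fin 2)) (hx : -x = x) : v x = 0 := by
  have h1 : v x = -v x := by simpa [hx] using hv x
  have h2 : (2 : ℝ) • v x = 0 := by
    rw [two_smul]
    nth_rewrite 2 [h1]
    simp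
  simpa using h2

/-- Logarithmic residence near a pinned stagnation point (planar lift; `u(t, x_c) = 0` with the
Lipschitz consequence `‖u(t,x)‖ ≤ Λ ‖x - x_c‖` on the `δ`-ball): an integral curve entering the
`r`-ball stays in the `δ`-ball for time at least `Λ⁻¹ log(δ/r)`. -/
def SaddleResidence : Prop :=
  ∀ (u : ℝ → EuclideanSpace ℝ (Fin 2) → EuclideanSpace ℝ (Fin 2)) (xc : EuclideanSpace ℝ (Fin 2))
    (Λ δ r t₀ : ℝ) (X : ℝ → EuclideanSpace ℝ (Fin 2)),
    0 < Λ → 0 < r → r < δ →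
    (∀ t x, x ∈ Metric.closedBall xc δ → ‖u t x‖ ≤ Λ * ‖x - xc‖) →
    (∀ t, HasDerivAt X (u t (X t)) t) →
    X t₀ ∈ Metric.closedBall xc r →
    ∀ t ∈ Icc t₀ (t₀ + Real.log (δ / r) / Λ), X t ∈ Metric.closedBall xc δ

/-- How the cards close the crux (shape only; both via X, FloorUpgrade's hypothesis being vacuous
for the listed freedoms — NOTES.md A4): any proof of the `(ABS)` clause for a family that already
carries `(U_h)` yields `UniformRelaxationWitness`, hence `FloorUpgrade` by weakening. -/
theorem floorUpgrade_of_witness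
    (hX : Summit.AnomalousDissipation.AnomalousDissipation.Theses.LimitingAbsorption.UniformRelaxationWitness) :
    Summit.AnomalousDissipation.AnomalousDissipation.Theses.LimitingAbsorption.FloorUpgrade :=
  fun _ => hX

end Summit.AnomalousDissipation.AnomalousDissipation.Cruxes.FloorUpgrade.Ideator2
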